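import Mathlib
import HarnessLib
import Summits.HubbardSuperconductivity.HubbardSuperconductivity.Theorems.KLProgrammeForwardBubblePlanar
import Summits.HubbardSuperconductivity.HubbardSuperconductivity.Theorems.KLProgrammeLatticeMatsubaraBubble
import Summits.HubbardSuperconductivity.HubbardSuperconductivity.Theorems.KLProgrammeMatsubaraSlicePropagatorSharp

/-!
# Route `KLProgramme` — crux K3, ENGINE child (stmt-HubbardSuperconductivity-19855 `KLRegimeEngineV12`): the forward particle–hole slice bubble ON THE MODEL
# CARRIER `MatsubaraIdx M × TorusSite 2 L` — periodic weight × periodic frame band, square cutoff, explicit Lipschitz constant (cell gate-hubbard-kl, seat hubbard-kl-k3c2-p2)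

Turnkey composition of `klfb_planar_bubble_norm_le` (planar, `ℝ × ℝ`) with `klfl_matsubara_latticeAverage_norm_le_scale` (lattice ↔ continuum): the
model's forward bubble is the torus average of the PERIODIC integrand `F_i(p) = a(p)·Φ_f(ω_i, ẽ(p))·Φ_{f'}(ω_i+q₀, ẽ'(p))` (`a`, `ẽ`, `ẽ'` doubly
`2π`-periodic: the sector/coupling weight, the frame band, the shifted frame band), while the planar estimate reads `h_i = klfb_integrand δ μ (a·ψ) f f' ẽ' ω_i q₀`
with the SQUARE CUTOFF `ψ = klfl_squareCut zm` (§1: `= 1` on `[−(π−2zm), π−2zm]²`, `= 0` off the open square, `2/zm`-Lipschitz); the ZONE MARGIN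
«`|ẽ| < 4Λ_n` on the closed square only where `|p_i| ≤ π − 2zm`» makes `F_i = h_i` on the square (§3).  §2: the Lipschitz constant of `F_i`
(`klfl_lipschitz_triple`, `klfl_prop_norm_le`, `klfl_prop_lipschitz_snd`).  §4: **`klfl_lattice_forward_bubble_norm_le`** — the same-slice-type forward bubble
(both weights with inner radius `Λ_n/2`) on the lattice: `≤ (planar bracket)/(2π) + 32Λ_n·K/L`, `K` explicit.  Pure analysis; nothing about the model's
effective action is asserted.
-/

noncomputable section

namespace Summit.HubbardSuperconductivity.HubbardSuperconductivity.Theorems.KLRegimeSplit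

set_option linter.dupNamespace false -- summit = problem name (single-conjunct summit), D-0017

open Real Set Filter MeasureTheory Complex Literature.MathematicalPhysics.QuantumLattice Literature.Probability.LatticeModels
open Literature.MathematicalPhysics.QuantumLattice.BandSectorCounting
open Summit.HubbardSuperconductivity.HubbardSuperconductivity.Theorems.PerturbedFermiCurve
open Summit.HubbardSuperconductivity.HubbardSuperconductivity.Theorems.KLProgrammeLegKernels
open scoped NNReal

/-! ## §1 The square cutoff -/

/-- The edge profile `η(u) = min 1 (max 0 ((π − zm − u)/zm))`: `1` for `u ≤ π − 2zm`, `0` for `u ≥ π − zm`. -/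
def klfl_edge (zm u : ℝ) : ℝ := min 1 (max 0 ((π - zm - u) / zm))

/-- **The square cutoff** `ψ(p) = η(|p₁|)·η(|p₂|)`. -/
def klfl_squareCut (zm : ℝ) (p : ℝ × ℝ) : ℝ := klfl_edge zm |p.1| * klfl_edge zm |p.2|

/-- `0 ≤ η ≤ 1`. -/
theorem klfl_edge_mem (zm u : ℝ) : klfl_edge zm u ∈ Icc (0 : ℝ) 1 := ⟨le_min zero_le_one (le_max_left _ _), min_le_left _ _⟩

/-- `η(u) = 1` for `u ≤ π − 2zm` (`zm > 0`). -/
theorem klfl_edge_eq_one {zm u : ℝ} (hzm : 0 < zm) (hu : u ≤ π - 2 * zm) : klfl_edge zm u = 1 := by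
  unfold klfl_edge
  have h1 : 1 ≤ (π - zm - u) / zm := by rw [le_div_iff₀ hzm]; linarith
  rw [min_eq_left (le_max_of_le_right h1)]

/-- `η(u) = 0` for `u ≥ π − zm` (`zm > 0`). -/
theorem klfl_edge_eq_zero {zm u : ℝ} (hzm : 0 < zm) (hu : π - zm ≤ u) : klfl_edge zm u = 0 := by
  unfold klfl_edge
  have h : (π - zm - u) / zm ≤ 0 := div_nonpos_of_nonpos_of_nonneg (by linarith) hzm.le
  rw [max_eq_left h, min_eq_right zero_le_one]

/-- `η` is `1/zm`-Lipschitz (`zm > 0`). -/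
theorem klfl_edge_lipschitz {zm : ℝ} (hzm : 0 < zm) (u u' : ℝ) : |klfl_edge zm u - klfl_edge zm u'| ≤ |u - u'| / zm := by
  unfold klfl_edge
  have h1 := abs_min_sub_min_le_max (1 : ℝ) (max 0 ((π - zm - u) / zm)) 1 (max 0 ((π - zm - u') / zm))
  have h2 := abs_max_sub_max_le_max (0 : ℝ) ((π - zm - u) / zm) 0 ((π - zm - u') / zm)
  simp only [sub_self, abs_zero] at h1 h2
  have h3 : |(π - zm - u) / zm - (π - zm - u') / zm| = |u - u'| / zm := by
    rw [← sub_div, abs_div, abs_of_pos hzm]; congr 1; rw [abs_sub_comm]; ring_nf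
  calc _ ≤ max 0 |max 0 ((π - zm - u) / zm) - max 0 ((π - zm - u') / zm)| := h1
    _ = |max 0 ((π - zm - u) / zm) - max 0 ((π - zm - u') / zm)| := max_eq_right (abs_nonneg _)
    _ ≤ max 0 |(π - zm - u) / zm - (π - zm - u') / zm| := h2
    _ = _ := by rw [max_eq_right (abs_nonneg _), h3]

/-- `η` is continuous. -/
theorem klfl_continuous_edge (zm : ℝ) : Continuous (klfl_edge zm) := by
  unfold klfl_edge; fun_prop

/-- `0 ≤ ψ ≤ 1`. -/
theorem klfl_squareCut_mem (zm : ℝ) (p : ℝ × ℝ) : klfl_squareCut zm p ∈ Icc (0 : ℝ) 1 := by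
  have h1 := klfl_edge_mem zm |p.1|; have h2 := klfl_edge_mem zm |p.2|
  exact ⟨mul_nonneg h1.1 h2.1, mul_le_one₀ h1.2 h2.1 h2.2⟩

/-- `ψ = 1` on `[−(π−2zm), π−2zm]²`. -/
theorem klfl_squareCut_eq_one {zm : ℝ} (hzm : 0 < zm) {p : ℝ × ℝ} (h1 : |p.1| ≤ π - 2 * zm) (h2 : |p.2| ≤ π - 2 * zm) :
    klfl_squareCut zm p = 1 := by
  rw [klfl_squareCut, klfl_edge_eq_one hzm h1, klfl_edge_eq_one hzm h2, mul_one]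

/-- `ψ p ≠ 0` forces `p` strictly inside the square: `|p₁| < π − zm`, `|p₂| < π − zm`. -/
theorem klfl_abs_lt_of_squareCut_ne_zero {zm : ℝ} (hzm : 0 < zm) {p : ℝ × ℝ} (h : klfl_squareCut zm p ≠ 0) :
    |p.1| < π - zm ∧ |p.2| < π - zm := by
  unfold klfl_squareCut at h
  constructor
  · by_contra hle
    exact h (by rw [klfl_edge_eq_zero hzm (not_lt.mp hle), zero_mul])
  · by_contra hle
    exact h (by rw [klfl_edge_eq_zero hzm (not_lt.mp hle), mul_zero])

/-- `ψ` is continuous. -/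
theorem klfl_continuous_squareCut (zm : ℝ) : Continuous (klfl_squareCut zm) := by
  unfold klfl_squareCut
  exact ((klfl_continuous_edge zm).comp (continuous_abs.comp continuous_fst)).mul
    ((klfl_continuous_edge zm).comp (continuous_abs.comp continuous_snd))

/-- `ψ` is `2/zm`-Lipschitz in the sup metric. -/
theorem klfl_squareCut_lipschitz {zm : ℝ} (hzm : 0 < zm) (p q : ℝ × ℝ) :
    |klfl_squareCut zm p - klfl_squareCut zm q| ≤ 2 / zm * dist p q := by
  unfold klfl_squareCut
  set a₁ := klfl_edge zm |p.1| with ha₁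
  set a₂ := klfl_edge zm |p.2| with ha₂
  set b₁ := klfl_edge zm |q.1| with hb₁
  set b₂ := klfl_edge zm |q.2| with hb₂
  have ha := klfl_edge_mem zm |p.1|; have hb := klfl_edge_mem zm |p.2|
  have ha' := klfl_edge_mem zm |q.1|; have hb' := klfl_edge_mem zm |q.2|
  rw [← ha₁] at ha; rw [← ha₂] at hb; rw [← hb₁] at ha'; rw [← hb₂] at hb'
  have h1 : |a₁ - b₁| ≤ dist p q / zm :=
    (klfl_edge_lipschitz hzm _ _).trans (div_le_div_of_nonneg_right
      ((abs_abs_sub_abs_le_abs_sub _ _).trans (by rw [← Real.dist_eq, Prod.dist_eq]; exact le_max_left _ _)) hzm.le)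
  have h2 : |a₂ - b₂| ≤ dist p q / zm :=
    (klfl_edge_lipschitz hzm _ _).trans (div_le_div_of_nonneg_right
      ((abs_abs_sub_abs_le_abs_sub _ _).trans (by rw [← Real.dist_eq, Prod.dist_eq]; exact le_max_right _ _)) hzm.le)
  have hsplit : a₁ * a₂ - b₁ * b₂ = (a₁ - b₁) * a₂ + b₁ * (a₂ - b₂) := by ring
  rw [hsplit]
  calc _ ≤ |(a₁ - b₁) * a₂| + |b₁ * (a₂ - b₂)| := abs_add_le _ _
    _ ≤ dist p q / zm * 1 + 1 * (dist p q / zm) := by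
        rw [abs_mul, abs_mul, abs_of_nonneg hb.1, abs_of_nonneg ha'.1]
        exact add_le_add (mul_le_mul h1 hb.2 hb.1 (by positivity)) (mul_le_mul ha'.2 h2 (abs_nonneg _) zero_le_one)
    _ = 2 / zm * dist p q := by ring

/-- Along a ray the sup distance is at most the parameter distance: `dist (t cos θ, t sin θ) (t' cos θ, t' sin θ) ≤ |t − t'|`. -/
theorem klfl_dist_ray_le (θ t t' : ℝ) : dist (t * Real.cos θ, t * Real.sin θ) (t' * Real.cos θ, t' * Real.sin θ) ≤ |t - t'| := by
  rw [Prod.dist_eq, Real.dist_eq, Real.dist_eq, ← sub_mul, ← sub_mul, abs_mul, abs_mul]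
  exact max_le (mul_le_of_le_one_right (abs_nonneg _) (Real.abs_cos_le_one θ))
    (mul_le_of_le_one_right (abs_nonneg _) (Real.abs_sin_le_one θ))

/-! ## §2 Lipschitz bookkeeping -/

/-- Lipschitz constant of a triple product of bounded Lipschitz functions (any pseudo-metric domain). -/
theorem klfl_lipschitz_triple {X : Type*} [PseudoMetricSpace X] {u v w : X → ℂ} {Mu Mv Mw Lu Lv Lw : ℝ}
    (hu : ∀ x, ‖u x‖ ≤ Mu) (hv : ∀ x, ‖v x‖ ≤ Mv) (hw : ∀ x, ‖w x‖ ≤ Mw)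
    (hlu : ∀ x y, ‖u x - u y‖ ≤ Lu * dist x y) (hlv : ∀ x y, ‖v x - v y‖ ≤ Lv * dist x y) (hlw : ∀ x y, ‖w x - w y‖ ≤ Lw * dist x y)
    (x y : X) :
    ‖u x * v x * w x - u y * v y * w y‖ ≤ (Lu * Mv * Mw + Mu * Lv * Mw + Mu * Mv * Lw) * dist x y := by
  have hMu : 0 ≤ Mu := (norm_nonneg _).trans (hu x)
  have hMv : 0 ≤ Mv := (norm_nonneg _).trans (hv x)
  have hMw : 0 ≤ Mw := (norm_nonneg _).trans (hw x)
  have hsplit : u x * v x * w x - u y * v y * w y =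
      (u x - u y) * v x * w x + u y * (v x - v y) * w x + u y * v y * (w x - w y) := by ring
  rw [hsplit]
  have hLu : 0 ≤ Lu * dist x y := (norm_nonneg _).trans (hlu x y)
  have hLv : 0 ≤ Lv * dist x y := (norm_nonneg _).trans (hlv x y)
  have h1 : ‖(u x - u y) * v x * w x‖ ≤ Lu * dist x y * Mv * Mw := by
    rw [norm_mul, norm_mul]
    exact mul_le_mul (mul_le_mul (hlu x y) (hv x) (norm_nonneg _) hLu) (hw x) (norm_nonneg _) (mul_nonneg hLu hMv)
  have h2 : ‖u y * (v x - v y) * w x‖ ≤ Mu * (Lv * dist x y) * Mw := by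
    rw [norm_mul, norm_mul]
    exact mul_le_mul (mul_le_mul (hu y) (hlv x y) (norm_nonneg _) hMu) (hw x) (norm_nonneg _) (mul_nonneg hMu hLv)
  have h3 : ‖u y * v y * (w x - w y)‖ ≤ Mu * Mv * (Lw * dist x y) := by
    rw [norm_mul, norm_mul]
    exact mul_le_mul (mul_le_mul (hu y) (hv y) (norm_nonneg _) hMu) (hlw x y) (norm_nonneg _) (by positivity)
  calc _ ≤ ‖(u x - u y) * v x * w x‖ + ‖u y * (v x - v y) * w x‖ + ‖u y * v y * (w x - w y)‖ := norm_add₃_le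
    _ ≤ Lu * dist x y * Mv * Mw + Mu * (Lv * dist x y) * Mw + Mu * Mv * (Lw * dist x y) := add_le_add (add_le_add h1 h2) h3
    _ = _ := by ring

/-- Sup bound of the slice propagator at scale `n` (inner radius `Λ_n/2`): `‖Φ_f(k₀,e)‖ ≤ 2M_f/Λ_n`. -/
theorem klfl_prop_norm_le {f : ℝ → ℂ} {Mf : ℝ} (hbd : ∀ s, ‖f s‖ ≤ Mf) {n : ℕ} (hin : ∀ s, s ≤ (klScale klE0 n / 2) ^ 2 → f s = 0)
    (k₀ e : ℝ) : ‖klfb_prop f k₀ e‖ ≤ 2 * Mf / klScale klE0 n := by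
  have hΛ := klth_klScale_pos n
  have h := klsp_div_propagator_norm_le hbd hin (by positivity : 0 < klScale klE0 n / 2) k₀ e
  rw [klfb_prop_apply]
  refine h.trans (le_of_eq ?_)
  field_simp

/-- `e`-Lipschitz constant of the slice propagator at scale `n`: `(9ℓ + 4M_f)/Λ_n²` (`klsq_propagator_lipschitz_scale`). -/
theorem klfl_prop_lipschitz_snd {f : ℝ → ℂ} {Lf Mf ℓ : ℝ} (hlip : ∀ s s', ‖f s - f s'‖ ≤ Lf * |s - s'|) (hbd : ∀ s, ‖f s‖ ≤ Mf) {n : ℕ}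
    (hLf : Lf ≤ ℓ / klScale klE0 n ^ 2) (hin : ∀ s, s ≤ (klScale klE0 n / 2) ^ 2 → f s = 0)
    (hout : ∀ s, (4 * klScale klE0 n) ^ 2 ≤ s → f s = 0) (k₀ e e' : ℝ) :
    ‖klfb_prop f k₀ e - klfb_prop f k₀ e'‖ ≤ (9 * ℓ + 4 * Mf) / klScale klE0 n ^ 2 * |e - e'| := by
  have h := klsq_propagator_lipschitz_scale hlip hbd hLf hin hout k₀ e k₀ e'
  rw [sub_self, abs_zero, zero_add] at h
  simpa only [klfb_prop_apply] using h

/-- The slice propagator vanishes for `|k₀| ≥ 4Λ_n`. -/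
theorem klfl_prop_eq_zero_of_le_abs_fst {f : ℝ → ℂ} {n : ℕ} (hout : ∀ s, (4 * klScale klE0 n) ^ 2 ≤ s → f s = 0) {k₀ : ℝ}
    (hk : 4 * klScale klE0 n ≤ |k₀|) (e : ℝ) : klfb_prop f k₀ e = 0 := by
  unfold klfb_prop
  rw [hout _ (by nlinarith [sq_abs k₀, sq_nonneg e, abs_nonneg k₀, (klth_klScale_pos n).le]), zero_div, zero_mul]

/-! ## §3 The periodic integrand against the cut-off planar integrand -/

section Square

variable {δ : (Fin 2 → ℝ) → ℝ} {μ zm : ℝ} {a : ℝ × ℝ → ℂ} {eb eb' : ℝ × ℝ → ℝ} {f f' : ℝ → ℂ} {n : ℕ}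

/-- **On the closed square the periodic integrand IS the cut-off planar integrand** (zone margin: the slice tube `|eb| < 4Λ_n` meets the closed
square only where `|p_i| ≤ π − 2zm`, and there `ψ = 1`; `eb =` the frame band on the square). -/
theorem klfl_integrand_eq_on_square (hzm : 0 < zm) (heb : ∀ p ∈ Icc (-π) π ×ˢ Icc (-π) π, eb p = klfb_band δ μ p)
    (hzone : ∀ p ∈ Icc (-π) π ×ˢ Icc (-π) π, |eb p| < 4 * klScale klE0 n → |p.1| ≤ π - 2 * zm ∧ |p.2| ≤ π - 2 * zm)
    (hout : ∀ s, (4 * klScale klE0 n) ^ 2 ≤ s → f s = 0) (k₀ q₀ : ℝ) {p : ℝ × ℝ} (hp : p ∈ Icc (-π) π ×ˢ Icc (-π) π) :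
    a p * klfb_prop f k₀ (eb p) * klfb_prop f' (k₀ + q₀) (eb' p) =
      klfb_integrand δ μ (fun p => a p * (klfl_squareCut zm p : ℂ)) f f' eb' k₀ q₀ p := by
  have hΛ := klth_klScale_pos n
  simp only [klfb_integrand]
  rw [← heb p hp]
  by_cases hΦ : klfb_prop f k₀ (eb p) = 0
  · simp only [hΦ, mul_zero, zero_mul]
  · have hlt := klfb_abs_lt_of_prop_ne_zero (by positivity : (0:ℝ) ≤ 4 * klScale klE0 n) hout hΦ
    obtain ⟨h1, h2⟩ := hzone p hp hlt
    rw [klfl_squareCut_eq_one hzm h1 h2, Complex.ofReal_one, mul_one]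

/-- Off the closed square the cut-off planar integrand vanishes. -/
theorem klfl_integrand_eq_zero_off_square (hzm : 0 < zm) (k₀ q₀ : ℝ) {p : ℝ × ℝ} (hp : p ∉ Icc (-π) π ×ˢ Icc (-π) π) :
    klfb_integrand δ μ (fun p => a p * (klfl_squareCut zm p : ℂ)) f f' eb' k₀ q₀ p = 0 := by
  have hψ : klfl_squareCut zm p = 0 := by
    by_contra hne
    obtain ⟨h1, h2⟩ := klfl_abs_lt_of_squareCut_ne_zero hzm hne
    exact hp ⟨abs_le.mp (by linarith), abs_le.mp (by linarith)⟩
  simp only [klfb_integrand, hψ, Complex.ofReal_zero, mul_zero, zero_mul]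

end Square

/-! ## §4 The forward slice bubble on the model carrier -/

section Lattice

variable {a' b' : ℝ} (B : BandBounds a' b') {δ : (Fin 2 → ℝ) → ℝ} (hδ1 : ContDiff ℝ 1 δ) {κ₀ κ₁ : ℝ}
  (hδ : ∀ k : Fin 2 → ℝ, (∀ i, |k i| ≤ π) → |δ k| ≤ κ₀)
  (hκ : ∀ k : Fin 2 → ℝ, (∀ i, |k i| ≤ π) → ‖fderiv ℝ δ k‖ ≤ κ₁) (hκ₁ : κ₁ < B.Dtmin)

include B hδ1 hδ hκ hκ₁ in
/-- **THE FORWARD SLICE BUBBLE ON `MatsubaraIdx M × TorusSite 2 L`** (same-slice-type weights: both with inner radius `Λ_n/2`).  Data: the frame (p4's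
hypotheses + radial `κ₂`, margin window); a doubly `2π`-periodic continuous weight `a` (`‖a‖ ≤ A₀`, `L_a`-Lipschitz, sup metric); the periodic frame band
`eb` (continuous, `L_e`-Lipschitz, `= klfb_band δ μ` on the closed square) and shifted band `eb'` (periodic, continuous, `L_e'`-Lipschitz,
`|eb' − e| ≤ δ_max` on the open square); the zone margin `zm > 0`; shell weights `f, f'` as in `klfb_planar_bubble_norm_le` plus `L_f ≤ ℓ_f/Λ_n²`.  Then, with
`A₁ := L_a + A₀·(2/zm)`, `K := L_a·(2M_f/Λ_n)(2M_f'/Λ_n) + A₀·((9ℓ_f+4M_f)L_e/Λ_n²)(2M_f'/Λ_n) + A₀(2M_f/Λ_n)((9ℓ'+4M_f')L_e'/Λ_n²)`: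
`‖β⁻¹•Σ_i L⁻²•Σ_k a(p_k)Φ_f(ω_i, eb(p_k))Φ_{f'}(ω_i+q₀, eb'(p_k))‖ ≤ (2π)⁻²·(2π·[ZS + thermal + shift bracket of `klfb_planar_bubble_norm_le` at (A₀, A₁)]) + 32Λ_n·K/L`. -/
theorem klfl_lattice_forward_bubble_norm_le
    {κ₂ : ℝ} (hκ₂ : 0 ≤ κ₂)
    (hD2 : ∀ θ s t : ℝ, s ∈ Icc 0 (π / ‖dir θ‖) → t ∈ Icc 0 (π / ‖dir θ‖) →
      |fderiv ℝ δ (s • dir θ) (dir θ) - fderiv ℝ δ (t • dir θ) (dir θ)| ≤ κ₂ * |s - t|)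
    {a : ℝ × ℝ → ℂ} (ha : Continuous a) (ha1 : ∀ x y, a (x + 2 * π, y) = a (x, y)) (ha2 : ∀ x y, a (x, y + 2 * π) = a (x, y))
    {A₀ La : ℝ} (hA0 : ∀ p, ‖a p‖ ≤ A₀) (hLa : ∀ p q, ‖a p - a q‖ ≤ La * dist p q)
    {eb : ℝ × ℝ → ℝ} (hebc : Continuous eb) (heb1 : ∀ x y, eb (x + 2 * π, y) = eb (x, y)) (heb2 : ∀ x y, eb (x, y + 2 * π) = eb (x, y))
    {Le : ℝ} (hLe : ∀ p q, |eb p - eb q| ≤ Le * dist p q) {μ : ℝ} (heb : ∀ p ∈ Icc (-π) π ×ˢ Icc (-π) π, eb p = klfb_band δ μ p)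
    {eb' : ℝ × ℝ → ℝ} (heb'c : Continuous eb') (heb'1 : ∀ x y, eb' (x + 2 * π, y) = eb' (x, y)) (heb'2 : ∀ x y, eb' (x, y + 2 * π) = eb' (x, y))
    {Le' : ℝ} (hLe' : ∀ p q, |eb' p - eb' q| ≤ Le' * dist p q) {δmax : ℝ} (hδ0 : 0 ≤ δmax)
    (he'δ : ∀ p : ℝ × ℝ, |p.1| < π → |p.2| < π → |eb' p - klfb_band δ μ p| ≤ δmax)
    {zm : ℝ} (hzm : 0 < zm) {n : ℕ}
    (hzone : ∀ p ∈ Icc (-π) π ×ˢ Icc (-π) π, |eb p| < 4 * klScale klE0 n → |p.1| ≤ π - 2 * zm ∧ |p.2| ≤ π - 2 * zm)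
    {f f' : ℝ → ℂ} {Lf Mf ℓf Lf' Mf' ℓ' LF MF ℓ : ℝ}
    (hlip : ∀ s s', ‖f s - f s'‖ ≤ Lf * |s - s'|) (hbd : ∀ s, ‖f s‖ ≤ Mf) (hLf : Lf ≤ ℓf / klScale klE0 n ^ 2)
    (hin : ∀ s, s ≤ (klScale klE0 n / 2) ^ 2 → f s = 0) (hout : ∀ s, (4 * klScale klE0 n) ^ 2 ≤ s → f s = 0)
    (hlip' : ∀ s s', ‖f' s - f' s'‖ ≤ Lf' * |s - s'|) (hbd' : ∀ s, ‖f' s‖ ≤ Mf') (hLf' : Lf' ≤ ℓ' / klScale klE0 n ^ 2)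
    (hin' : ∀ s, s ≤ (klScale klE0 n / 2) ^ 2 → f' s = 0) (hout' : ∀ s, (4 * klScale klE0 n) ^ 2 ≤ s → f' s = 0)
    (hMF : 0 ≤ MF) (hFlip : ∀ s s', ‖f s * f' s - f s' * f' s'‖ ≤ LF * |s - s'|) (hFbd : ∀ s, ‖f s * f' s‖ ≤ MF)
    (hLF : LF ≤ ℓ / klScale klE0 n ^ 2)
    (hlo : a' < μ - 4 * klScale klE0 n - κ₀) (hhi : μ + 4 * klScale klE0 n + κ₀ < b')
    (q₀ : ℝ) {β : ℝ} (hβ : klBetaMin ≤ β) (hn : n ≤ nScales β + 1) {M : ℕ}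
    (hM : β * (4 * klScale klE0 n) / (2 * Real.pi) + 1 ≤ M) (L : ℕ) [NeZero L] :
    ‖β⁻¹ • ∑ i : MatsubaraIdx M, ((L ^ 2 : ℕ) : ℝ)⁻¹ • ∑ k : TorusSite 2 L,
        a (latticeMomentum L k 0, latticeMomentum L k 1) *
          klfb_prop f (matsubaraFreq β M i) (eb (latticeMomentum L k 0, latticeMomentum L k 1)) *
            klfb_prop f' (matsubaraFreq β M i + q₀) (eb' (latticeMomentum L k 0, latticeMomentum L k 1))‖ ≤
      ((2 * π) ^ 2)⁻¹ *
          (2 * Real.pi *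
            (524288 / Real.pi * (ℓ + 8 * MF) *
                (Real.pi * Real.sqrt 2 / (B.Dtmin - κ₁) * (La + A₀ * (2 / zm)) / (B.Dtmin - κ₁) +
                  A₀ * (1 / (B.Dtmin - κ₁) ^ 2 + Real.pi * Real.sqrt 2 * (2 + κ₂) / (B.Dtmin - κ₁) ^ 3)) * klScale klE0 n +
              393216 / Real.pi * (ℓ + 8 * MF) * (A₀ * (Real.pi * Real.sqrt 2 / (B.Dtmin - κ₁))) * ((Real.pi / β) / klScale klE0 n) +
              1024 / Real.pi * Mf * (48 * ℓ' + 193 * Mf') * (A₀ * (Real.pi * Real.sqrt 2 / (B.Dtmin - κ₁))) * (|q₀| + δmax) /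
                klScale klE0 n)) +
        32 * klScale klE0 n *
            (La * (2 * Mf / klScale klE0 n) * (2 * Mf' / klScale klE0 n) +
              A₀ * ((9 * ℓf + 4 * Mf) / klScale klE0 n ^ 2 * Le) * (2 * Mf' / klScale klE0 n) +
              A₀ * (2 * Mf / klScale klE0 n) * ((9 * ℓ' + 4 * Mf') / klScale klE0 n ^ 2 * Le')) / L := by
  have hΛ := klth_klScale_pos n
  have hr₁ : 0 < klScale klE0 n / 2 := by positivity
  have hr : 0 < 4 * klScale klE0 n := by positivity
  have hA0' : 0 ≤ A₀ := (norm_nonneg _).trans (hA0 0)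
  have hLa0 : 0 ≤ La := by
    have h := hLa (1, 0) (0, 0)
    have hd : (0 : ℝ) < dist ((1 : ℝ), (0 : ℝ)) ((0 : ℝ), (0 : ℝ)) := by rw [Prod.dist_eq]; simp
    exact nonneg_of_mul_nonneg_left ((norm_nonneg _).trans h) hd
  have hLe0 : 0 ≤ Le := by
    have h := hLe (1, 0) (0, 0)
    have hd : (0 : ℝ) < dist ((1 : ℝ), (0 : ℝ)) ((0 : ℝ), (0 : ℝ)) := by rw [Prod.dist_eq]; simp
    exact nonneg_of_mul_nonneg_left ((abs_nonneg _).trans h) hd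
  have hLe'0 : 0 ≤ Le' := by
    have h := hLe' (1, 0) (0, 0)
    have hd : (0 : ℝ) < dist ((1 : ℝ), (0 : ℝ)) ((0 : ℝ), (0 : ℝ)) := by rw [Prod.dist_eq]; simp
    exact nonneg_of_mul_nonneg_left ((abs_nonneg _).trans h) hd
  have hMf : 0 ≤ Mf := (norm_nonneg _).trans (hbd 0)
  have hMf' : 0 ≤ Mf' := (norm_nonneg _).trans (hbd' 0)
  have hℓf : 0 ≤ 9 * ℓf + 4 * Mf := by
    have hLf0 : 0 ≤ Lf := by have := hlip 0 1; norm_num at this; linarith [norm_nonneg (f 0 - f 1)]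
    have : 0 ≤ ℓf := by
      have h := hLf0.trans hLf; rwa [le_div_iff₀ (by positivity), zero_mul] at h
    positivity
  have hℓ' : 0 ≤ 9 * ℓ' + 4 * Mf' := by
    have hLf0 : 0 ≤ Lf' := by have := hlip' 0 1; norm_num at this; linarith [norm_nonneg (f' 0 - f' 1)]
    have : 0 ≤ ℓ' := by
      have h := hLf0.trans hLf'; rwa [le_div_iff₀ (by positivity), zero_mul] at h
    positivity
  -- the planar weight `A = a·ψ`
  set A : ℝ × ℝ → ℂ := fun p => a p * (klfl_squareCut zm p : ℂ) with hAdef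
  have hψbd : ∀ p, ‖(klfl_squareCut zm p : ℂ)‖ ≤ 1 := fun p => by
    rw [Complex.norm_real, Real.norm_of_nonneg (klfl_squareCut_mem zm p).1]; exact (klfl_squareCut_mem zm p).2
  have hAc : Continuous A := ha.mul (Complex.continuous_ofReal.comp (klfl_continuous_squareCut zm))
  have hAsupp : ∀ p : ℝ × ℝ, A p ≠ 0 → |p.1| < π ∧ |p.2| < π := by
    intro p hp
    have hψ : klfl_squareCut zm p ≠ 0 := fun h0 => hp (by simp only [hAdef, h0, Complex.ofReal_zero, mul_zero])
    obtain ⟨h1, h2⟩ := klfl_abs_lt_of_squareCut_ne_zero hzm hψ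
    exact ⟨by linarith, by linarith⟩
  have hAbd : ∀ p, ‖A p‖ ≤ A₀ := fun p => by
    simp only [hAdef]; rw [norm_mul]
    calc ‖a p‖ * ‖(klfl_squareCut zm p : ℂ)‖ ≤ A₀ * 1 := mul_le_mul (hA0 p) (hψbd p) (norm_nonneg _) hA0'
      _ = A₀ := mul_one _
  have hArad : ∀ θ t t' : ℝ, 0 ≤ t → 0 ≤ t' →
      ‖A (t * Real.cos θ, t * Real.sin θ) - A (t' * Real.cos θ, t' * Real.sin θ)‖ ≤ (La + A₀ * (2 / zm)) * |t - t'| := by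
    intro θ t t' _ _
    set x := (t * Real.cos θ, t * Real.sin θ) with hx
    set y := (t' * Real.cos θ, t' * Real.sin θ) with hy
    have hd : dist x y ≤ |t - t'| := klfl_dist_ray_le θ t t'
    have hsplit : A x - A y = (a x - a y) * (klfl_squareCut zm x : ℂ) + a y * ((klfl_squareCut zm x : ℂ) - (klfl_squareCut zm y : ℂ)) := by
      simp only [hAdef]; ring
    rw [hsplit]
    have h1 : ‖(a x - a y) * (klfl_squareCut zm x : ℂ)‖ ≤ La * |t - t'| * 1 := by
      rw [norm_mul]
      exact mul_le_mul ((hLa x y).trans (mul_le_mul_of_nonneg_left hd hLa0)) (hψbd x) (norm_nonneg _) (by positivity)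
    have h2 : ‖a y * ((klfl_squareCut zm x : ℂ) - (klfl_squareCut zm y : ℂ))‖ ≤ A₀ * (2 / zm * |t - t'|) := by
      rw [norm_mul, ← Complex.ofReal_sub, Complex.norm_real, Real.norm_eq_abs]
      exact mul_le_mul (hA0 y) ((klfl_squareCut_lipschitz hzm x y).trans (mul_le_mul_of_nonneg_left hd (by positivity)))
        (abs_nonneg _) hA0'
    calc _ ≤ ‖(a x - a y) * (klfl_squareCut zm x : ℂ)‖ + ‖a y * ((klfl_squareCut zm x : ℂ) - (klfl_squareCut zm y : ℂ))‖ := norm_add_le _ _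
      _ ≤ La * |t - t'| * 1 + A₀ * (2 / zm * |t - t'|) := add_le_add h1 h2
      _ = (La + A₀ * (2 / zm)) * |t - t'| := by ring
  -- the planar bound
  have hB := klfb_planar_bubble_norm_le B hδ1 hδ hκ hκ₁ hAc hAsupp hAbd hArad hκ₂ hD2 hlip hbd hin hout hlip' hbd' hLf' hin' hout'
    hMF hFlip hFbd hLF heb'c hδ0 he'δ hlo hhi q₀ hβ hn hM
  -- the periodic family and its properties
  set F : MatsubaraIdx M → ℝ × ℝ → ℂ := fun i p =>
    a p * klfb_prop f (matsubaraFreq β M i) (eb p) * klfb_prop f' (matsubaraFreq β M i + q₀) (eb' p) with hFdef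
  have hΦc : ∀ k₀, Continuous fun e => klfb_prop f k₀ e := fun k₀ => klfb_continuous_prop_snd hlip hbd hin hout hr₁ hr k₀
  have hΨc : ∀ k₀, Continuous fun e => klfb_prop f' k₀ e := fun k₀ => klfb_continuous_prop_snd hlip' hbd' hin' hout' hr₁ hr k₀
  have hFc : ∀ i, Continuous (F i) := fun i => (ha.mul ((hΦc _).comp hebc)).mul ((hΨc _).comp heb'c)
  have hF1 : ∀ i x y, F i (x + 2 * π, y) = F i (x, y) := fun i x y => by simp only [hFdef, ha1, heb1, heb'1]
  have hF2 : ∀ i x y, F i (x, y + 2 * π) = F i (x, y) := fun i x y => by simp only [hFdef, ha2, heb2, heb'2]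
  set K : ℝ := La * (2 * Mf / klScale klE0 n) * (2 * Mf' / klScale klE0 n) +
    A₀ * ((9 * ℓf + 4 * Mf) / klScale klE0 n ^ 2 * Le) * (2 * Mf' / klScale klE0 n) +
    A₀ * (2 * Mf / klScale klE0 n) * ((9 * ℓ' + 4 * Mf') / klScale klE0 n ^ 2 * Le') with hKdef
  have hK0 : 0 ≤ K := by rw [hKdef]; positivity
  have hFlip' : ∀ i (p q : ℝ × ℝ), ‖F i p - F i q‖ ≤ (K.toNNReal : ℝ) * dist p q := by
    intro i p q
    rw [Real.coe_toNNReal _ hK0]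
    have hv : ∀ p q : ℝ × ℝ, ‖klfb_prop f (matsubaraFreq β M i) (eb p) - klfb_prop f (matsubaraFreq β M i) (eb q)‖ ≤
        (9 * ℓf + 4 * Mf) / klScale klE0 n ^ 2 * Le * dist p q :=
      fun p q => (klfl_prop_lipschitz_snd hlip hbd hLf hin hout (matsubaraFreq β M i) (eb p) (eb q)).trans (by
        rw [mul_assoc]; exact mul_le_mul_of_nonneg_left (hLe p q) (by positivity))
    have hw : ∀ p q : ℝ × ℝ, ‖klfb_prop f' (matsubaraFreq β M i + q₀) (eb' p) - klfb_prop f' (matsubaraFreq β M i + q₀) (eb' q)‖ ≤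
        (9 * ℓ' + 4 * Mf') / klScale klE0 n ^ 2 * Le' * dist p q :=
      fun p q => (klfl_prop_lipschitz_snd hlip' hbd' hLf' hin' hout' (matsubaraFreq β M i + q₀) (eb' p) (eb' q)).trans (by
        rw [mul_assoc]; exact mul_le_mul_of_nonneg_left (hLe' p q) (by positivity))
    exact klfl_lipschitz_triple (u := a) (v := fun p => klfb_prop f (matsubaraFreq β M i) (eb p))
      (w := fun p => klfb_prop f' (matsubaraFreq β M i + q₀) (eb' p))
      hA0 (fun p => klfl_prop_norm_le hbd hin (matsubaraFreq β M i) (eb p))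
      (fun p => klfl_prop_norm_le hbd' hin' (matsubaraFreq β M i + q₀) (eb' p)) hLa hv hw p q
  have hFh : ∀ i, ∀ p ∈ Icc (-π) π ×ˢ Icc (-π) π, F i p = klfb_integrand δ μ A f f' eb' (matsubaraFreq β M i) q₀ p :=
    fun i p hp => klfl_integrand_eq_on_square hzm heb hzone hout (matsubaraFreq β M i) q₀ hp
  have hh0 : ∀ i, ∀ p ∉ Icc (-π) π ×ˢ Icc (-π) π, klfb_integrand δ μ A f f' eb' (matsubaraFreq β M i) q₀ p = 0 :=
    fun i p hp => klfl_integrand_eq_zero_off_square hzm (matsubaraFreq β M i) q₀ hp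
  have hzero : ∀ i, 4 * klScale klE0 n ≤ |matsubaraFreq β M i| → ∀ p, F i p = 0 := by
    intro i hi p
    simp only [hFdef]
    rw [klfl_prop_eq_zero_of_le_abs_fst hout hi, mul_zero, zero_mul]
  have h := klfl_matsubara_latticeAverage_norm_le_scale (F := F) (h := fun i => klfb_integrand δ μ A f f' eb' (matsubaraFreq β M i) q₀)
    hβ hn hFc hF1 hF2 hFlip' hFh hh0 hzero hB L
  rw [Real.coe_toNNReal _ hK0] at h
  exact h

end Lattice

end Summit.HubbardSuperconductivity.HubbardSuperconductivity.Theorems.KLRegimeSplit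

end
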